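/-
Copyright (c) 2026 the pub-hodgecm-mathlib formalisation cell (harness21).  Prover seat hodgecm-mathlib-K2E3-p11 (g10) (valve hand), Track B «K2-LIT»,
#184♮ = hLiu418 = `stmt-HodgeConjecture-24832`; socket #41, KIND W — KW desk F0P2-p08 (g3) DEAL 2026-09-05T01:00:37Z (KW-arch-hBL) and census 01:03:09Z
«honest split»: FILE 1 = the SIGN DISPATCH of the per-place archimedean letter WITH A GROWTH FACE for the SAME continuation (LH4-p08 (g11) «=» 01:04:41Z takes the
definite growth siblings, FILE 2; the assembler `hBL_of_placeGrowth` is FILE 3).  THEOREMS ONLY (no `def`, no `instance`, no notation, no named-fact hypothesis, no `sorry`).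
-/
import Summits.HodgeConjecture.HodgeConjecture.Theorems.K2LiuKindWArchWhittakerLetterDispatch   -- ★ p863827 (this seat): `sign_trichotomy`, `twistedIntegral_eq_of_picture_eq`
import HarnessLib

/-!
# Crux `HLiu418`, socket #41, KIND W — `K2LiuKindWArchWhittakerGrowthDispatch`: the per-place archimedean Whittaker letter WITH GROWTH, dispatched on the sign of the index

Cell `hodgecm-mathlib`, crux item hLiu418 = `stmt-HodgeConjecture-24832` (helper lane `--supports … --as helper`, count-neutral).  ★ p863827
`K2LiuKindWArchWhittakerLetterDispatch.hW_of_signCases` pays the per-place CONTINUATION letter `hW'` of the (x-a) column; the (iii-arch) column's last by-value letter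
`hBL` of ★ `K2LiuKindWBlockOfRecordCMOfLocalLettersHaar.kindW_block_cm_of_localLetters_haar` (:170–185) needs, per place, a GROWTH bound for the SAME continuation `Ew`
(census 01:03:09Z (a): on `{0 < re}` the continued arch letter is `Cst(s)·Σ_r c_r ∏_w Ew_{r,w}(s)` by canonicity of ★ `halfPlaneContinuation`, so `‖Finf‖ ≤ |Cst|·Σ|c_r|·∏‖Ew‖`).
THIS FILE is the sign dispatch for the PAIR (formula, growth), SHAPE-AGNOSTIC in the growth face: the face is an abstract predicate
`Gr : ιS → ιh → W → Carrier → (ℂ → ℂ) → Prop` on the continuation (the tie instantiates it with the (ii″) telescope of the census — `T₂` entrywise, `cg = π∕2`, `N′ ≥ 0`,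
∀-form over the hermitian-`R` Iwasawa letters, LH4-p08 01:04:41Z), and the three heads are BY VALUE per datum `(S, h, w, Q)`:
POSITIVE DEFINITE `hPos` ∕ NEGATIVE DEFINITE `hNeg` (LH4-p08's FILE 2 siblings `exists_twistedWhittaker_continuation_growth_of_posDef∕_of_negDef` of ★ p863390 ∕ ★ NegDef),
INDEFINITE `hInd` (the «Φ6b-ind» organ's (R3)+(R4), K2E4-p11), each `⊢ ∃ Ew s₀, DifferentiableOn ℂ Ew {0<re} ∧ ‹formula on {s₀<re}› ∧ Gr S h w Q Ew`.
* §1 `formula_of_abscissa_of_hol` — the NON-EXISTENTIAL twin of ★ p863827 §2 `hW_of_abscissa_of_hol`: the identity-theorem upgrade `{s₀<re} ⇒ {s₁<re}` for a GIVEN continuation `Ew`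
  (so the growth face, a statement about that very `Ew`, survives the upgrade), under the same holomorphy letter `hhol` (★-payable: LH4-p10's (KW-arch-hW-hol) `hWhol_of_std`).
* §2 HEAD `hWgr_of_signCases` ⊢ `∀ S, good S → ∀ h w Q, ∃ Ew, DifferentiableOn ℂ Ew {0<re} ∧ ‹the hW' formula on {s₁<re}, ★ p863827's bytes› ∧ Gr S h w Q Ew`
  (★ `sign_trichotomy` on `hidx S h w`; the chosen head's `Ew` keeps its growth face and has its formula face moved to `s₁` by §1).
References: [Shimura1997] §16.4, §18.4; [KudlaRallis1994] §1; [MoeglinWaldspurger1995] IV.1.9.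
HONEST LABEL.  Count-neutral helper; after it the (iii-arch) growth letter `hBL` rests on {the two definite growth siblings (FILE 2), «Φ6b-ind» (R3)+(R4), (KW-arch-hW-hol),
the assembler FILE 3}: `HC_CM` is proved only modulo the 7 printed citations (2 remaining named inputs: hLiu418 = `stmt-HodgeConjecture-24832`, h413 = `stmt-HodgeConjecture-24833`)
until rung 0 closes.
-/

set_option autoImplicit false
set_option linter.dupNamespace false -- the mandated namespace repeats `HodgeConjecture.HodgeConjecture`

noncomputable section

open Complex Matrix MeasureTheory
open scoped ComplexConjugate ComplexOrder Topology

namespace Summit.HodgeConjecture.HodgeConjecture.Cruxes.HLiu418.K2LiuKindWArchWhittakerGrowthDispatch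

open Summit.HodgeConjecture.HodgeConjecture.Cruxes.HLiu418.K2LiuArchInducedTubeDefs
open Summit.HodgeConjecture.HodgeConjecture.Cruxes.HLiu418.K2LiuU22CompactPictureDefs
open Summit.HodgeConjecture.HodgeConjecture.Cruxes.HLiu418.K2LiuKindWArchWhittakerKPicture (det_ne_zero_of_unitary)
open Summit.HodgeConjecture.HodgeConjecture.Cruxes.HLiu418.K2LiuKindWArchWhittakerLetterDispatch (sign_trichotomy twistedIntegral_eq_of_picture_eq)

/-! ## §1 The abscissa upgrade for a GIVEN continuation -/

/-- **THE ABSCISSA UPGRADE `{s₀ < re} ⇒ {s₁ < re}` FOR A GIVEN CONTINUATION `Ew`** (non-existential twin of ★ `hW_of_abscissa_of_hol`).  Fix `χ, Q`, a frame `(x, g)` in `U(J)`,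
a twist `e`, `0 ≤ s₁`, the holomorphy letter `hhol` (through any section of picture `Q` on `{s₁ < re}`, one family of sections of picture `Q` with holomorphic twisted integral),
and a continuation `Ew` holomorphic on `{0 < re}` for which the letter holds on `{s₀ < re}`.  Then the letter holds for THIS `Ew` on `{s₁ < re}` (canonicity on `U(J)` ★
`twistedIntegral_eq_of_picture_eq` + identity theorem on the convex `{s₁ < re}`, `z₀ := max s₀ s₁ + 1`). [cite: MoeglinWaldspurger1995, IV.1.9] [cite: Shimura1997, §18.4] -/
theorem formula_of_abscissa_of_hol {χ : ℂ → ℂ} {Q : Carrier} {x g : Matrix (Fin 2 ⊕ Fin 2) (Fin 2 ⊕ Fin 2) ℂ}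
    (hx : xᴴ * Matrix.J (Fin 2) ℂ * x = Matrix.J (Fin 2) ℂ) (hg : gᴴ * Matrix.J (Fin 2) ℂ * g = Matrix.J (Fin 2) ℂ)
    {e : Matrix (Fin 2) (Fin 2) ℂ → ℂ} {s₁ : ℝ} (hs₁ : 0 ≤ s₁)
    (hhol : ∀ s' : ℂ, s₁ < s'.re → ∀ F₀ : Matrix (Fin 2 ⊕ Fin 2) (Fin 2 ⊕ Fin 2) ℂ → ℂ, IsArchSiegelSection χ s' F₀ →
      (∀ (v : Matrix (Fin 2) (Fin 2) ℂ), vᴴ * v = 1 → ∀ hv : v.det ≠ 0,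
        F₀ ((2 : ℂ)⁻¹ • fromBlocks (1 + v) (-(I • (1 - v))) (I • (1 - v)) (1 + v) : Matrix (Fin 2 ⊕ Fin 2) (Fin 2 ⊕ Fin 2) ℂ) = evalAt v hv Q) →
      ∃ G : ℂ → Matrix (Fin 2 ⊕ Fin 2) (Fin 2 ⊕ Fin 2) ℂ → ℂ, (∀ s : ℂ, s₁ < s.re → IsArchSiegelSection χ s (G s)) ∧
      (∀ s : ℂ, s₁ < s.re → ∀ (v : Matrix (Fin 2) (Fin 2) ℂ), vᴴ * v = 1 → ∀ hv : v.det ≠ 0,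
        G s ((2 : ℂ)⁻¹ • fromBlocks (1 + v) (-(I • (1 - v))) (I • (1 - v)) (1 + v) : Matrix (Fin 2 ⊕ Fin 2) (Fin 2 ⊕ Fin 2) ℂ) = evalAt v hv Q) ∧
      DifferentiableOn ℂ (fun s : ℂ => ∫ r : Fin 2 → Fin 2 → ℝ, G s (x * fromBlocks 1 (hermOfReal r) 0 1 * g) * e (hermOfReal r)) {s : ℂ | s₁ < s.re})
    {Ew : ℂ → ℂ} {s₀ : ℝ} (hEw : DifferentiableOn ℂ Ew {s : ℂ | 0 < s.re})
    (hform : ∀ s : ℂ, s₀ < s.re → ∀ F : Matrix (Fin 2 ⊕ Fin 2) (Fin 2 ⊕ Fin 2) ℂ → ℂ, IsArchSiegelSection χ s F →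
        (∀ (v : Matrix (Fin 2) (Fin 2) ℂ), vᴴ * v = 1 → ∀ hv : v.det ≠ 0,
          F ((2 : ℂ)⁻¹ • fromBlocks (1 + v) (-(I • (1 - v))) (I • (1 - v)) (1 + v) : Matrix (Fin 2 ⊕ Fin 2) (Fin 2 ⊕ Fin 2) ℂ) = evalAt v hv Q) →
        ∫ r : Fin 2 → Fin 2 → ℝ, F (x * fromBlocks 1 (hermOfReal r) 0 1 * g) * e (hermOfReal r) = Ew s) :
    ∀ s : ℂ, s₁ < s.re → ∀ F : Matrix (Fin 2 ⊕ Fin 2) (Fin 2 ⊕ Fin 2) ℂ → ℂ, IsArchSiegelSection χ s F →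
      (∀ (v : Matrix (Fin 2) (Fin 2) ℂ), vᴴ * v = 1 → ∀ hv : v.det ≠ 0,
        F ((2 : ℂ)⁻¹ • fromBlocks (1 + v) (-(I • (1 - v))) (I • (1 - v)) (1 + v) : Matrix (Fin 2 ⊕ Fin 2) (Fin 2 ⊕ Fin 2) ℂ) = evalAt v hv Q) →
      ∫ r : Fin 2 → Fin 2 → ℝ, F (x * fromBlocks 1 (hermOfReal r) 0 1 * g) * e (hermOfReal r) = Ew s := by
  intro s hs F hF hFQ
  obtain ⟨G, hG, hGQ, hGhol⟩ := hhol s hs F hF hFQ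
  have hU : IsOpen {s : ℂ | s₁ < s.re} := isOpen_lt continuous_const Complex.continuous_re
  have hUc : IsPreconnected {s : ℂ | s₁ < s.re} := (convex_halfSpace_re_gt s₁).isPreconnected
  have hV : IsOpen {s : ℂ | max s₀ s₁ < s.re} := isOpen_lt continuous_const Complex.continuous_re
  set z₀ : ℂ := ((max s₀ s₁ + 1 : ℝ) : ℂ) with hz₀
  have hre : z₀.re = max s₀ s₁ + 1 := by rw [hz₀, Complex.ofReal_re]
  have hz₀U : z₀ ∈ {s : ℂ | s₁ < s.re} := by
    show s₁ < z₀.re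
    rw [hre]
    exact lt_of_le_of_lt (le_max_right s₀ s₁) (lt_add_one _)
  have hz₀V : z₀ ∈ {s : ℂ | max s₀ s₁ < s.re} := by
    show max s₀ s₁ < z₀.re
    rw [hre]
    exact lt_add_one _
  have hev : Ew =ᶠ[𝓝 z₀] fun s : ℂ => ∫ r : Fin 2 → Fin 2 → ℝ, G s (x * fromBlocks 1 (hermOfReal r) 0 1 * g) * e (hermOfReal r) := by
    filter_upwards [hV.mem_nhds hz₀V] with s' hs'
    have h₀ : s₀ < s'.re := lt_of_le_of_lt (le_max_left s₀ s₁) hs'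
    have h₁ : s₁ < s'.re := lt_of_le_of_lt (le_max_right s₀ s₁) hs'
    exact (hform s' h₀ (G s') (hG s' h₁) (hGQ s' h₁)).symm
  have hEwU : AnalyticOnNhd ℂ Ew {s : ℂ | s₁ < s.re} :=
    (hEw.mono fun s (hs : s₁ < s.re) => lt_of_le_of_lt hs₁ hs).analyticOnNhd hU
  have hEqOn := hEwU.eqOn_of_preconnected_of_eventuallyEq (hGhol.analyticOnNhd hU) hUc hz₀U hev
  have hpic : ∀ v : Matrix (Fin 2) (Fin 2) ℂ, vᴴ * v = 1 →
      F ((2 : ℂ)⁻¹ • fromBlocks (1 + v) (-(I • (1 - v))) (I • (1 - v)) (1 + v) : Matrix (Fin 2 ⊕ Fin 2) (Fin 2 ⊕ Fin 2) ℂ) =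
        G s ((2 : ℂ)⁻¹ • fromBlocks (1 + v) (-(I • (1 - v))) (I • (1 - v)) (1 + v) : Matrix (Fin 2 ⊕ Fin 2) (Fin 2 ⊕ Fin 2) ℂ) := fun v hv => by
    rw [hFQ v hv (det_ne_zero_of_unitary hv), hGQ s hs v hv (det_ne_zero_of_unitary hv)]
  rw [twistedIntegral_eq_of_picture_eq hF (hG s hs) hpic hx hg e]
  exact (hEqOn hs).symm

/-! ## §2 HEAD — the letter with growth, dispatched on the sign type of the framed index -/

/-- **THE PER-PLACE ARCHIMEDEAN WHITTAKER LETTER WITH GROWTH, BY SIGN CASES.**  Data as in ★ `hW_of_signCases` (guard `good`, weights `k`, frames `B C Pt` in `U(J)`, twist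
`eb`, index `hidx` hermitian and non-degenerate under the guard, abscissa `0 ≤ s₁`, holomorphy letter `hWhol`), an ABSTRACT growth face `Gr S h w Q Ew` on continuations, and
the three heads BY VALUE per datum — `hPos` at `(hidx S h w).PosDef`, `hNeg` at `(-hidx S h w).PosDef`, `hInd` at `(hidx S h w).det.re < 0` — each producing a continuation
with its formula face on `{s₀ < re}` AND its growth face.  CONCLUSION: under the guard, ONE continuation `Ew` per `(S, h, w, Q)` with BOTH the `hW'` formula face on `{s₁ < re}`
(★ p863827's bytes) and the growth face `Gr S h w Q Ew` (★ `sign_trichotomy`, §1). [cite: Shimura1997, §16.4, §18.4] [cite: KudlaRallis1994, §1] [cite: MoeglinWaldspurger1995, IV.1.9] -/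
theorem hWgr_of_signCases {ιS ιh W : Type*} (good : ιS → Prop) (k : W → ℤ)
    (B C : W → Matrix (Fin 2) (Fin 2) ℂ)
    (hx : ∀ w, (fromBlocks 0 (B w) (C w) 0 : Matrix (Fin 2 ⊕ Fin 2) (Fin 2 ⊕ Fin 2) ℂ)ᴴ * Matrix.J (Fin 2) ℂ *
      (fromBlocks 0 (B w) (C w) 0 : Matrix (Fin 2 ⊕ Fin 2) (Fin 2 ⊕ Fin 2) ℂ) = Matrix.J (Fin 2) ℂ)
    (Pt : ιS → ιh → W → Matrix (Fin 2 ⊕ Fin 2) (Fin 2 ⊕ Fin 2) ℂ) (hPt : ∀ S h w, (Pt S h w)ᴴ * Matrix.J (Fin 2) ℂ * Pt S h w = Matrix.J (Fin 2) ℂ)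
    (eb : ιS → ιh → W → Matrix (Fin 2) (Fin 2) ℂ → ℂ) (hidx : ιS → ιh → W → Matrix (Fin 2) (Fin 2) ℂ)
    (hherm : ∀ S h w, (hidx S h w)ᴴ = hidx S h w) (hdet : ∀ S, good S → ∀ h w, (hidx S h w).det ≠ 0)
    (s₁ : ℝ) (hs₁ : 0 ≤ s₁)
    (hWhol : ∀ (S : ιS), good S → ∀ (h : ιh) (w : W) (Q : Carrier), ∀ s' : ℂ, s₁ < s'.re → ∀ F₀ : Matrix (Fin 2 ⊕ Fin 2) (Fin 2 ⊕ Fin 2) ℂ → ℂ,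
      IsArchSiegelSection (fun z : ℂ => (conj z / ((‖z‖ : ℝ) : ℂ)) ^ (k w)) s' F₀ →
      (∀ (v : Matrix (Fin 2) (Fin 2) ℂ), vᴴ * v = 1 → ∀ hv : v.det ≠ 0,
        F₀ ((2 : ℂ)⁻¹ • fromBlocks (1 + v) (-(I • (1 - v))) (I • (1 - v)) (1 + v) : Matrix (Fin 2 ⊕ Fin 2) (Fin 2 ⊕ Fin 2) ℂ) = evalAt v hv Q) →
      ∃ G : ℂ → Matrix (Fin 2 ⊕ Fin 2) (Fin 2 ⊕ Fin 2) ℂ → ℂ,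
      (∀ s : ℂ, s₁ < s.re → IsArchSiegelSection (fun z : ℂ => (conj z / ((‖z‖ : ℝ) : ℂ)) ^ (k w)) s (G s)) ∧
      (∀ s : ℂ, s₁ < s.re → ∀ (v : Matrix (Fin 2) (Fin 2) ℂ), vᴴ * v = 1 → ∀ hv : v.det ≠ 0,
        G s ((2 : ℂ)⁻¹ • fromBlocks (1 + v) (-(I • (1 - v))) (I • (1 - v)) (1 + v) : Matrix (Fin 2 ⊕ Fin 2) (Fin 2 ⊕ Fin 2) ℂ) = evalAt v hv Q) ∧
      DifferentiableOn ℂ (fun s : ℂ => ∫ r : Fin 2 → Fin 2 → ℝ,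
        G s ((fromBlocks 0 (B w) (C w) 0 : Matrix (Fin 2 ⊕ Fin 2) (Fin 2 ⊕ Fin 2) ℂ) * fromBlocks 1 (hermOfReal r) 0 1 * Pt S h w) * eb S h w (hermOfReal r))
        {s : ℂ | s₁ < s.re})
    (Gr : ιS → ιh → W → Carrier → (ℂ → ℂ) → Prop)
    (hPos : ∀ (S : ιS), good S → ∀ (h : ιh) (w : W) (Q : Carrier), (hidx S h w).PosDef →
      ∃ (Ew : ℂ → ℂ) (s₀ : ℝ), DifferentiableOn ℂ Ew {s : ℂ | 0 < s.re} ∧ (∀ s : ℂ, s₀ < s.re →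
        ∀ F : Matrix (Fin 2 ⊕ Fin 2) (Fin 2 ⊕ Fin 2) ℂ → ℂ, IsArchSiegelSection (fun z : ℂ => (conj z / ((‖z‖ : ℝ) : ℂ)) ^ (k w)) s F →
          (∀ (v : Matrix (Fin 2) (Fin 2) ℂ), vᴴ * v = 1 → ∀ hv : v.det ≠ 0,
            F ((2 : ℂ)⁻¹ • fromBlocks (1 + v) (-(I • (1 - v))) (I • (1 - v)) (1 + v) : Matrix (Fin 2 ⊕ Fin 2) (Fin 2 ⊕ Fin 2) ℂ) = evalAt v hv Q) →
          ∫ x : Fin 2 → Fin 2 → ℝ, F ((fromBlocks 0 (B w) (C w) 0 : Matrix (Fin 2 ⊕ Fin 2) (Fin 2 ⊕ Fin 2) ℂ) * fromBlocks 1 (hermOfReal x) 0 1 * Pt S h w) *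
            eb S h w (hermOfReal x) = Ew s) ∧ Gr S h w Q Ew)
    (hNeg : ∀ (S : ιS), good S → ∀ (h : ιh) (w : W) (Q : Carrier), (-hidx S h w).PosDef →
      ∃ (Ew : ℂ → ℂ) (s₀ : ℝ), DifferentiableOn ℂ Ew {s : ℂ | 0 < s.re} ∧ (∀ s : ℂ, s₀ < s.re →
        ∀ F : Matrix (Fin 2 ⊕ Fin 2) (Fin 2 ⊕ Fin 2) ℂ → ℂ, IsArchSiegelSection (fun z : ℂ => (conj z / ((‖z‖ : ℝ) : ℂ)) ^ (k w)) s F →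
          (∀ (v : Matrix (Fin 2) (Fin 2) ℂ), vᴴ * v = 1 → ∀ hv : v.det ≠ 0,
            F ((2 : ℂ)⁻¹ • fromBlocks (1 + v) (-(I • (1 - v))) (I • (1 - v)) (1 + v) : Matrix (Fin 2 ⊕ Fin 2) (Fin 2 ⊕ Fin 2) ℂ) = evalAt v hv Q) →
          ∫ x : Fin 2 → Fin 2 → ℝ, F ((fromBlocks 0 (B w) (C w) 0 : Matrix (Fin 2 ⊕ Fin 2) (Fin 2 ⊕ Fin 2) ℂ) * fromBlocks 1 (hermOfReal x) 0 1 * Pt S h w) *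
            eb S h w (hermOfReal x) = Ew s) ∧ Gr S h w Q Ew)
    (hInd : ∀ (S : ιS), good S → ∀ (h : ιh) (w : W) (Q : Carrier), (hidx S h w).det.re < 0 →
      ∃ (Ew : ℂ → ℂ) (s₀ : ℝ), DifferentiableOn ℂ Ew {s : ℂ | 0 < s.re} ∧ (∀ s : ℂ, s₀ < s.re →
        ∀ F : Matrix (Fin 2 ⊕ Fin 2) (Fin 2 ⊕ Fin 2) ℂ → ℂ, IsArchSiegelSection (fun z : ℂ => (conj z / ((‖z‖ : ℝ) : ℂ)) ^ (k w)) s F →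
          (∀ (v : Matrix (Fin 2) (Fin 2) ℂ), vᴴ * v = 1 → ∀ hv : v.det ≠ 0,
            F ((2 : ℂ)⁻¹ • fromBlocks (1 + v) (-(I • (1 - v))) (I • (1 - v)) (1 + v) : Matrix (Fin 2 ⊕ Fin 2) (Fin 2 ⊕ Fin 2) ℂ) = evalAt v hv Q) →
          ∫ x : Fin 2 → Fin 2 → ℝ, F ((fromBlocks 0 (B w) (C w) 0 : Matrix (Fin 2 ⊕ Fin 2) (Fin 2 ⊕ Fin 2) ℂ) * fromBlocks 1 (hermOfReal x) 0 1 * Pt S h w) *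
            eb S h w (hermOfReal x) = Ew s) ∧ Gr S h w Q Ew) :
    ∀ (S : ιS), good S → ∀ (h : ιh) (w : W) (Q : Carrier), ∃ Ew : ℂ → ℂ, DifferentiableOn ℂ Ew {s : ℂ | 0 < s.re} ∧ (∀ s : ℂ, s₁ < s.re →
      ∀ F : Matrix (Fin 2 ⊕ Fin 2) (Fin 2 ⊕ Fin 2) ℂ → ℂ, IsArchSiegelSection (fun z : ℂ => (conj z / ((‖z‖ : ℝ) : ℂ)) ^ (k w)) s F →
        (∀ (v : Matrix (Fin 2) (Fin 2) ℂ), vᴴ * v = 1 → ∀ hv : v.det ≠ 0,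
          F ((2 : ℂ)⁻¹ • fromBlocks (1 + v) (-(I • (1 - v))) (I • (1 - v)) (1 + v) : Matrix (Fin 2 ⊕ Fin 2) (Fin 2 ⊕ Fin 2) ℂ) = evalAt v hv Q) →
        ∫ x : Fin 2 → Fin 2 → ℝ, F ((fromBlocks 0 (B w) (C w) 0 : Matrix (Fin 2 ⊕ Fin 2) (Fin 2 ⊕ Fin 2) ℂ) * fromBlocks 1 (hermOfReal x) 0 1 * Pt S h w) *
          eb S h w (hermOfReal x) = Ew s) ∧ Gr S h w Q Ew := by
  intro S hS h w Q
  -- one head by the sign trichotomy of the index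
  have hhead : ∃ (Ew : ℂ → ℂ) (s₀ : ℝ), DifferentiableOn ℂ Ew {s : ℂ | 0 < s.re} ∧ (∀ s : ℂ, s₀ < s.re →
      ∀ F : Matrix (Fin 2 ⊕ Fin 2) (Fin 2 ⊕ Fin 2) ℂ → ℂ, IsArchSiegelSection (fun z : ℂ => (conj z / ((‖z‖ : ℝ) : ℂ)) ^ (k w)) s F →
        (∀ (v : Matrix (Fin 2) (Fin 2) ℂ), vᴴ * v = 1 → ∀ hv : v.det ≠ 0,
          F ((2 : ℂ)⁻¹ • fromBlocks (1 + v) (-(I • (1 - v))) (I • (1 - v)) (1 + v) : Matrix (Fin 2 ⊕ Fin 2) (Fin 2 ⊕ Fin 2) ℂ) = evalAt v hv Q) →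
        ∫ x : Fin 2 → Fin 2 → ℝ, F ((fromBlocks 0 (B w) (C w) 0 : Matrix (Fin 2 ⊕ Fin 2) (Fin 2 ⊕ Fin 2) ℂ) * fromBlocks 1 (hermOfReal x) 0 1 * Pt S h w) *
          eb S h w (hermOfReal x) = Ew s) ∧ Gr S h w Q Ew := by
    rcases sign_trichotomy (hherm S h w) (hdet S hS h w) with hpos | hneg | hind
    · exact hPos S hS h w Q hpos
    · exact hNeg S hS h w Q hneg
    · exact hInd S hS h w Q hind
  obtain ⟨Ew, s₀, hEw, hform, hgr⟩ := hhead
  exact ⟨Ew, hEw, formula_of_abscissa_of_hol (hx w) (hPt S h w) hs₁ (hWhol S hS h w Q) hEw hform, hgr⟩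

end Summit.HodgeConjecture.HodgeConjecture.Cruxes.HLiu418.K2LiuKindWArchWhittakerGrowthDispatch

end
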